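import Mathlib
import Summits.Ventures.HodgeRepro.Tier4.Line1.RTFSetting
import Summits.Ventures.HodgeRepro.Tier4.Line1.InnerCalculus
import Summits.Ventures.HodgeRepro.Tier4.Line1.GeneratedSubspace
import Summits.Ventures.HodgeRepro.Tier4.Line1.HeckeIsolation
import Summits.Ventures.HodgeRepro.Tier4.Line1.HeckeRankOneOfBlock
import Summits.Ventures.HodgeRepro.Tier4.Line1.HeckeBlockWeak
import Summits.Ventures.HodgeRepro.Tier4.Line1.HeckeBlockSpherical

/-!
# Tier4/Line1/HeckeBlockIdempotent — the Hecke block of ANY idempotent test function: the four identities of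
`HeckeBlockW` from `e ⋆ e = e`, `e* = e` and the composition law (one block shape for the trivial type and for the
σ-isotypic idempotent of (S3σ))

Blind re-derivation cell `pub-hodge-repro`, Tier 4 (README §9–§10), seat t4-L1-p5 (prover, LINE L1, gen 3; plan-1's
ask S14082 «the consumer shape for the type-σ block», answered S14087).  Target tree path
`lean/Summits/Ventures/HodgeRepro/Tier4/Line1/HeckeBlockIdempotent.lean`.  Imports this seat's `HeckeBlockWeak`
(p685856: `HeckeBlockW`), `HeckeBlockSpherical` (p686211: `indK`, its identities), t4-L1-p2's `GeneratedSubspace`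
(`R_R_eq_R_conv`, the composition law `R(f′)(R(f) ψ) = R(f′ ⋆ f) ψ`), t4-L1-p4's `InnerCalculus`
(`inner_R_eq_inner_R_adj`).

WHAT THIS IS.  `HeckeBlockW` displays a level idempotent `e` with four identities.  For the idempotent `R(e)` of a
TEST FUNCTION `e` that is an idempotent of the convolution algebra (`e ⋆ e = e`) and self-adjoint (`conj (e(g⁻¹)) =
e(g)`), all four identities are THEOREMS on the fixed space `Vb = {ψ invariant, continuous, R(e) ψ = ψ}`:
`he_mem` (invariant-subspace stability + `R(e)(R(e)ψ) = R(e ⋆ e) ψ = R(e) ψ`), `he_id` (definitional on the fixed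
space), `he_R` (`R(f)(R(e) ψ) = R(f ⋆ e) ψ = R(f) ψ` for the Hecke elements `f = f ⋆ e`), `he_adj` (the adjoint identity
with `e* = e`).  `IdempotentData` bundles the inputs (the idempotent, the fixed block with its `H`-module structure
`hact`, the Hecke elements with `f ⋆ e = f`, the per-constituent data `W`/`π`/(C1)/(C2)); `IdempotentData.toHeckeBlockW`
is the block; `exists_isolatedAt_idempotent` = (S3a) with the isolating pair in the Hecke algebra.  The trivial type is
the instance `e := indK` (`conv_indK_indK`, `cj_refl_indK`, `isTest_indK`; the fixed space of `R(indK)` is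
`sphericalBlock S K`: `mem_sphericalBlock_iff_fixed`), the corner forms' type σ the instance `e := eσ` of (S3σ)
(t4-L1-p3 g3, `Tier4/Line1/IsotypicIdempotent`: `isTest_eσ`, `conv_eσ_eσ`, `cj_refl_eσ`) — one block shape for both.
What stays DISPLAYED: the finite-dimensionality of the fixed block (`[FiniteDimensional ℂ Vb]`: p1's `levelBlock` for
`e` = matrix coefficients, p686211 for the trivial type), the `H`-module structure (`hact`, the convolution law on the
block), the Hecke property `f ⋆ e = f`, the projections, (C1), (C2).  Nothing of them is proved.  Nothing here says
anything about the status of the Hodge conjecture for CM abelian varieties, which is NOT proved (HC_CM is NOT proved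
by anyone in this repository).
-/

set_option autoImplicit false

noncomputable section

namespace Summit.Ventures.HodgeRepro.Tier4.Line1

open MeasureTheory Topology

namespace RTF.Setting

variable {G : Type} [Group G] [TopologicalSpace G] [IsTopologicalGroup G] [MeasurableSpace G] [BorelSpace G]
  (S : Setting G)

/-- **THE DATA OF AN IDEMPOTENT HECKE BLOCK**: an idempotent self-adjoint test function `e`, its fixed block `Vb`
(the continuous invariant functions fixed by `R(e)`) with an `H`-module structure given by the right-regular action
of Hecke elements `tst r` satisfying `tst r ⋆ e = tst r`, and the per-constituent data of the block (`W i = τ (idx i) ∩ Vb`,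
projections `π`, (C1), (C2)).  Every field is a HYPOTHESIS; nothing is constructed here. -/
structure IdempotentData (τ : ℕ → Set (G → ℂ)) (m : ℕ) (H : Type) [Ring H] [Algebra ℂ H] (ι : Type) [Fintype ι]
    [DecidableEq ι] (Vb : Submodule ℂ (G → ℂ)) [FiniteDimensional ℂ Vb] [Module H Vb] [IsScalarTower ℂ H Vb] where
  /-- the idempotent test function -/
  e : G → ℂ
  /-- it is a test function -/
  he : IsTest e
  /-- `e ⋆ e = e` -/
  he_conv : S.conv e e = e
  /-- `e* = e`: `conj (e g⁻¹) = e g` -/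
  he_sym : cj (refl e) = e
  /-- the block is the fixed space of `R(e)` on the continuous invariant functions -/
  hVb : ∀ ψ : G → ℂ, ψ ∈ Vb ↔ S.Invariant ψ ∧ Continuous ψ ∧ S.R e ψ = ψ
  /-- the Hecke elements as test functions -/
  tst : H → (G → ℂ)
  /-- every Hecke element is a test function -/
  htst : ∀ r, IsTest (tst r)
  /-- the Hecke elements are right-`e`-invariant: `tst r ⋆ e = tst r` -/
  htst_conv : ∀ r, S.conv (tst r) e = tst r
  /-- the `H`-action on the block IS the right-regular action of the test functions (the convolution law) -/
  hact : ∀ (r : H) (ψ : Vb), ((r • ψ : Vb) : G → ℂ) = S.R (tst r) ψ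
  /-- the constituents of the block, by index -/
  idx : ι → ℕ
  /-- the index of `τ m` -/
  i₀ : ι
  /-- `τ m` is the `i₀`-th constituent -/
  hi₀ : idx i₀ = m
  /-- the constituents as `H`-submodules of the block -/
  W : ι → Submodule H Vb
  /-- `W i = τ (idx i) ∩ Vb` -/
  hW : ∀ (i : ι) (ψ : Vb), ψ ∈ W i ↔ (ψ : G → ℂ) ∈ τ (idx i)
  /-- the `H`-linear projections onto the constituents -/
  π : ι → Vb →ₗ[H] Vb
  /-- `π i` lands in `W i` -/
  hπmem : ∀ i v, π i v ∈ W i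
  /-- the projections sum to the identity -/
  hπsum : ∀ v, ∑ i, π i v = v
  /-- `π i` is the identity on `W i` -/
  hπid : ∀ i, ∀ w ∈ W i, π i w = w
  /-- `π i` kills `W j` for `j ≠ i` -/
  hπzero : ∀ i j, i ≠ j → ∀ w ∈ W j, π i w = 0
  /-- (C1): every constituent of the block is a simple `H`-module -/
  [simple : ∀ i, IsSimpleModule H (W i)]
  /-- (C2): the constituents are pairwise non-isomorphic `H`-modules -/
  hnon : ∀ i j, i ≠ j → IsEmpty ((W i) ≃ₗ[H] (W j))

namespace IdempotentData

variable {S} {τ : ℕ → Set (G → ℂ)} {m : ℕ} {H : Type} [Ring H] [Algebra ℂ H] {ι : Type} [Fintype ι] [DecidableEq ι]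
  {Vb : Submodule ℂ (G → ℂ)} [FiniteDimensional ℂ Vb] [Module H Vb] [IsScalarTower ℂ H Vb]
  (D : IdempotentData S τ m H ι Vb)

/-- **THE FOUR IDENTITIES ARE THEOREMS FOR AN IDEMPOTENT TEST FUNCTION**: the `HeckeBlockW` of an `IdempotentData`,
with `e := R(D.e)` — `he_mem` from invariant-subspace stability and `R(e)(R(e)ψ) = R(e ⋆ e)ψ`, `he_id` by definition of the
fixed block, `he_R` from `R(f)(R(e)ψ) = R(f ⋆ e)ψ = R(f)ψ`, `he_adj` from p4's adjoint identity and `e* = e`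
(p2's composition law `R_R_eq_R_conv` throughout). -/
def toHeckeBlockW [SecondCountableTopology G] [T2Space G] [MeasurableMul G] [SFinite S.μ]
    (hinv : ∀ m', S.IsInvariantSubspace (τ m')) : HeckeBlockW S τ m H ι Vb where
  tst := D.tst
  htst := D.htst
  hact := D.hact
  idx := D.idx
  i₀ := D.i₀
  hi₀ := D.hi₀
  W := D.W
  hW := D.hW
  π := D.π
  hπmem := D.hπmem
  hπsum := D.hπsum
  hπid := D.hπid
  hπzero := D.hπzero
  simple := D.simple
  hnon := D.hnon
  e := S.R D.e
  he_mem := fun m' ψ hψ =>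
    have hconv : S.R D.e ψ ∈ τ m' := (hinv m').conv ψ hψ _ D.he
    ⟨(D.hVb _).mpr ⟨(hinv m').inv _ hconv, (hinv m').cont _ hconv, by
      rw [S.R_R_eq_R_conv D.he D.he ((hinv m').cont ψ hψ), D.he_conv]⟩, hconv⟩
  he_R := fun r m' ψ hψ => by
    rw [S.R_R_eq_R_conv (D.htst r) D.he ((hinv m').cont ψ hψ), D.htst_conv r]
  he_adj := fun m' ψ hψ v hv => by
    rw [S.inner_R_eq_inner_R_adj D.he ((hinv m').inv ψ hψ) ((hinv m').cont ψ hψ) ((D.hVb v).mp hv).1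
      ((D.hVb v).mp hv).2.1, D.he_sym]
  he_id := fun v hv => ((D.hVb v).mp hv).2.2

/-- **(S3a) ON AN IDEMPOTENT BLOCK**: the isolating pair in the Hecke algebra from the data of an idempotent block and
the two toric periods on its admissible vectors. -/
theorem exists_isolatedAt [Countable S.Gk] [MeasurableMul G] [SecondCountableTopology G] [T2Space G] [SFinite S.μ]
    {χ : S.T → ℂ} {χ' : S.T' → ℂ} {φ : ℕ → G → ℂ} {n : ℕ → ℕ} (hB : S.IsAdaptedONB τ φ n)
    (hT : ∃ w ∈ blockAdmissible τ m Vb, S.periodT χ (fun t => w t) ≠ 0)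
    (hT' : ∃ w' ∈ blockAdmissible τ m Vb, S.periodT' χ' (fun t' => w' t') ≠ 0) :
    ∃ r r' : H, IsolatedAt S χ χ' φ n (cj (D.tst r)) (refl (D.tst r')) m :=
  (D.toHeckeBlockW hB.inv).exists_isolatedAt_hecke hB hT hT'

end IdempotentData

section SphericalInstance

variable (K : Subgroup G)

omit [IsTopologicalGroup G] in
/-- `indK` is an idempotent of the convolution algebra: `indK ⋆ indK = indK`. -/
theorem conv_indK_indK (hKo : IsOpen (K : Set G)) (hKc : IsCompact (K : Set G)) :
    S.conv (indK S K) (indK S K) = indK S K := by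
  funext g
  unfold conv
  by_cases hg : g ∈ K
  · have h : (fun h => indK S K h * indK S K (h⁻¹ * g)) =
        (K : Set G).indicator fun _ => (((S.μ K).toReal⁻¹ : ℝ) : ℂ) * (((S.μ K).toReal⁻¹ : ℝ) : ℂ) := by
      funext h
      by_cases hh : h ∈ K
      · rw [S.indK_of_mem K hh, S.indK_of_mem K (K.mul_mem (K.inv_mem hh) hg),
          Set.indicator_of_mem (show h ∈ (K : Set G) from hh)]
      · rw [S.indK_of_not_mem K hh, zero_mul, Set.indicator_of_notMem (show h ∉ (K : Set G) from hh)]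
    rw [h, integral_indicator hKo.measurableSet, setIntegral_const, Complex.real_smul, Measure.real, ← mul_assoc,
      S.measure_mul_inv_eq_one K hKo hKc, one_mul, S.indK_of_mem K hg]
  · have h : (fun h => indK S K h * indK S K (h⁻¹ * g)) = fun _ => 0 := by
      funext h
      by_cases hh : h ∈ K
      · have hng : h⁻¹ * g ∉ K := fun h' => hg (by
          have := K.mul_mem hh h'
          rwa [mul_inv_cancel_left] at this)
        rw [S.indK_of_not_mem K hng, mul_zero]
      · rw [S.indK_of_not_mem K hh, zero_mul]
    rw [h, integral_zero, S.indK_of_not_mem K hg]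

/-- the spherical block is the fixed space of `R(indK)` on the continuous invariant functions (`K` compact open). -/
theorem mem_sphericalBlock_iff_fixed [MeasurableMul G] (hKo : IsOpen (K : Set G)) (hKc : IsCompact (K : Set G))
    (ψ : G → ℂ) : ψ ∈ sphericalBlock S K ↔ S.Invariant ψ ∧ Continuous ψ ∧ S.R (indK S K) ψ = ψ := by
  constructor
  · intro hψ
    exact ⟨hψ.1, S.continuous_of_mem_sphericalBlock K hKo hψ, S.R_indK_of_right_invariant K hKo hKc hψ.2⟩
  · rintro ⟨hinv, _, hfix⟩
    refine ⟨hinv, fun x k hk => ?_⟩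
    rw [← hfix]
    exact S.R_mul_right_of_left_invariant K (S.indK_left_invariant K) ψ hk x

end SphericalInstance

end RTF.Setting

end Summit.Ventures.HodgeRepro.Tier4.Line1

end
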